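import Summits.HodgeConjecture.HodgeConjecture.Theorems.EightfoldBlochSeedsChernCharacterOnBettiAnalytificationIso
import HarnessLib

/-!
# K1 (analytification bridge), step K1h: the topological Chern CHARACTER of an analytification in
# `complexBetti` — rational, independent of the datum, generically trivial in positive degrees, `ch₁` algebraic

Route `EightfoldBlochSeeds` / item `stmt-HodgeConjecture-19780` (`ChernCharacterOnBetti`), helper
(`--supports`). HONEST FRAMING: nothing here proves 19780 / 18880 / 18882 / 18883 / H2 / HC_AV / HC;
no definition, no named fact.

WHAT. The tree already has the topological Chern character
`theChernClassTheory.topologicalChernCharacter ℂ E k = s_k(E)/k! ∈ H²ᵏ(X(ℂ); ℂ) = complexBetti X (2 * k)`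
(`CharacteristicClasses.TopologicalChernClasses`: Newton power sums of the integral Chern classes,
changed to `ℂ`-coefficients and divided by `k!`; with `_zero`, `_one`, `_two`, `_trivial`,
`_pullback`, `_congr`, `_succ_of_rank_le_one` = the fields `ch_free_*`, `map_ch`, `ch_congr`,
`ch_of_hasRankLE_one` of `ChernCharacterBetti` on the topological side). Applied to a topological
analytification `(E, α)` of an algebraic vector bundle (steps 2–4, K1b, K1c) this file records the
candidate `ch X F k := ch_k(F(ℂ))` has the properties `ChernCharacterBetti` asks that do not involve
functoriality in `X` or exact sequences:

* `isRationalClass_topologicalChernCharacter` — `ch_k(E)` is a rational class (`s_k(E)` is integral;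
  field `isRationalClass_ch`);
* `topologicalChernCharacter_eq_of_comparison` — `ch_k` does not depend on the analytification datum
  (K1b `exists_iso_of_comparison`; field `ch_congr`, datum half);
* `chernPowerSum_restrictToOpen_eq_zero_of_comparison`,
  `topologicalChernCharacter_restrictToOpen_eq_zero_of_comparison`,
  `topologicalChernCharacter_mem_coniveauFiltration_one_of_comparison` — for `k ≥ 1`, `s_k(E)` and
  `ch_k(E)` die on every trivialising Zariski open and `ch_k(E) ∈ N¹ H²ᵏ(X(ℂ); ℂ)` (Newton's
  polynomials have no constant term);
* `topologicalChernCharacter_one_mem_algebraicClasses_of_comparison` — `ch₁(E) = c₁(E)_ℂ` is an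
  algebraic class (field `ch_mem_algebraicClasses`, degree one).

[cite: Hirzebruch1966, §10.1] [cite: HusemollerFibreBundles1994, Ch. 17 §3 (C₁) and Ch. 20 Def. 8.2]
[cite: SerreGAGA1956, §3 n°9 Prop. 10] [cite: BlochOgus1974ENS, (3.8)]
-/

noncomputable section

-- single-problem summit (Problem = Summit): the mandated namespace repeats `HodgeConjecture`.
set_option linter.dupNamespace false

open CategoryTheory AlgebraicGeometry Bundle Topology
open Literature.AlgebraicGeometry.Motives Literature.AlgebraicGeometry.HodgeTheory
open Literature.AlgebraicTopology.SingularHomology Literature.AlgebraicTopology.CharacteristicClasses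

namespace Summit.HodgeConjecture.HodgeConjecture.Theorems

variable {n : ℕ} {X : SchemeOver ℂ} {F : X.left.Modules} {r : ℕ}

/-- **`ch_k(E) ∈ complexBetti X (2 * k)` is a rational class**: `s_k(E)` is an integral class and
`ch_k = (k!)⁻¹ s_k`. [cite: Hirzebruch1966, §10.1] [cite: VoisinHodgeI2002, Thm. 11.23] -/
theorem isRationalClass_topologicalChernCharacter (E : ComplexVectorBundle.{0, 0} (ComplexPoints X)) (k : ℕ) :
    IsRationalClass (theChernClassTheory.topologicalChernCharacter ℂ E k : complexBetti X (2 * k)) := by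
  have hint : IsIntegralClass (singularCohomology.ringChange (Int.castRingHom ℂ) (ComplexPoints X) (2 * k)
      (theChernClassTheory.chernPowerSum E k)) := by
    induction theChernClassTheory.chernPowerSum E k using singularCohomology_induction_on with
    | h ζ =>
      refine ⟨cocyclesRingChange (Int.castRingHom ℂ) (2 * k) ζ, (singularCohomology.ringChange_π _ ζ).symm,
        fun σ ↦ ⟨coFn ζ σ, ?_⟩⟩
      change ((coFn ζ σ : ℤ) : ℂ) = coFn (cocyclesRingChange (Int.castRingHom ℂ) (2 * k) ζ) σ
      rw [coFn_cocyclesRingChange, Function.comp_apply, eq_intCast]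
  have hq : (((Nat.factorial k : ℕ) : ℂ))⁻¹ = (((Nat.factorial k : ℕ) : ℚ)⁻¹ : ℚ) := by
    rw [Rat.cast_inv, Rat.cast_natCast]
  change IsRationalClass ((((Nat.factorial k : ℕ) : ℂ))⁻¹ • _)
  rw [hq]
  exact hint.isRationalClass.smul _

/-- **`ch_k` of an algebraic vector bundle does not depend on the analytification datum** (two data
are isomorphic, K1b; `ch_k` is an isomorphism invariant). [cite: SerreGAGA1956, §3 n°9 Prop. 10]
[cite: HusemollerFibreBundles1994, Ch. 17 §3 (C₁)] -/
theorem topologicalChernCharacter_eq_of_comparison (hX : IsSmoothProjective n X)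
    (hF : ∀ x : X.left, ∃ (U : X.left.Opens) (s : Fin r → Γ(F, U)), x ∈ U ∧ IsSectionFrame F U s)
    (E E' : ComplexVectorBundle.{0, 0} (ComplexPoints X))
    (α : ∀ U : X.left.Opens, Γ(F, U) → ∀ P : ComplexPoints X, E.E P)
    (α' : ∀ U : X.left.Opens, Γ(F, U) → ∀ P : ComplexPoints X, E'.E P)
    (hadd : ∀ (U : X.left.Opens) (σ τ : Γ(F, U)) (P : ComplexPoints X), α U (σ + τ) P = α U σ P + α U τ P)
    (hsmul : ∀ (U : X.left.Opens) (f : Γ(X.left, U)) (σ : Γ(F, U)) (P : ComplexPoints X) (h : P.pt ∈ U),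
      α U (f • σ) P = P.eval U h f • α U σ P)
    (hres : ∀ (U W : X.left.Opens) (hWU : W ≤ U) (σ : Γ(F, U)) (P : ComplexPoints X), P.pt ∈ W →
      α W (F.presheaf.map (homOfLE hWU).op σ) P = α U σ P)
    (hcont : ∀ (U : X.left.Opens) (σ : Γ(F, U)),
      ContinuousOn (fun P ↦ (⟨P, α U σ P⟩ : TotalSpace E.F E.E)) {P | P.pt ∈ U})
    (hframe : ∀ (U : X.left.Opens) (t : Fin r → Γ(F, U)), IsSectionFrame F U t →
      ∀ P : ComplexPoints X, P.pt ∈ U → LinearIndependent ℂ (fun j ↦ α U (t j) P) ∧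
        ⊤ ≤ Submodule.span ℂ (Set.range fun j ↦ α U (t j) P))
    (hadd' : ∀ (U : X.left.Opens) (σ τ : Γ(F, U)) (P : ComplexPoints X), α' U (σ + τ) P = α' U σ P + α' U τ P)
    (hsmul' : ∀ (U : X.left.Opens) (f : Γ(X.left, U)) (σ : Γ(F, U)) (P : ComplexPoints X) (h : P.pt ∈ U),
      α' U (f • σ) P = P.eval U h f • α' U σ P)
    (hres' : ∀ (U W : X.left.Opens) (hWU : W ≤ U) (σ : Γ(F, U)) (P : ComplexPoints X), P.pt ∈ W →
      α' W (F.presheaf.map (homOfLE hWU).op σ) P = α' U σ P)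
    (hcont' : ∀ (U : X.left.Opens) (σ : Γ(F, U)),
      ContinuousOn (fun P ↦ (⟨P, α' U σ P⟩ : TotalSpace E'.F E'.E)) {P | P.pt ∈ U})
    (hframe' : ∀ (U : X.left.Opens) (t : Fin r → Γ(F, U)), IsSectionFrame F U t →
      ∀ P : ComplexPoints X, P.pt ∈ U → LinearIndependent ℂ (fun j ↦ α' U (t j) P) ∧
        ⊤ ≤ Submodule.span ℂ (Set.range fun j ↦ α' U (t j) P)) (k : ℕ) :
    theChernClassTheory.topologicalChernCharacter ℂ E k = theChernClassTheory.topologicalChernCharacter ℂ E' k := by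
  haveI := ComplexPoints.t2Space_of_isSmoothProjective hX
  haveI := paracompactSpace_complexPoints_of_isSmoothProjective hX
  rcases isEmpty_or_nonempty (ComplexPoints X) with hB | hB
  · exact (ModuleCat.eq_zero_of_isZero_obj (isZero_singularCohomology_of_isEmpty' ℂ (ComplexPoints X) (2 * k)) _).trans
      (ModuleCat.eq_zero_of_isZero_obj (isZero_singularCohomology_of_isEmpty' ℂ (ComplexPoints X) (2 * k)) _).symm
  · obtain ⟨e, -⟩ := exists_iso_of_comparison hF E E' α α' hadd hsmul hres hcont hframe hadd' hsmul' hres' hcont' hframe'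
    exact theChernClassTheory.topologicalChernCharacter_congr ℂ e (ComplexVectorBundle.Iso.rank_eq e) k

/-- **The power sums `s_k(E)` (`k ≥ 1`) die on every trivialising Zariski open, integrally**: they are
polynomials without constant term (Newton) in the Chern classes, which die there (step 3).
[cite: Hirzebruch1966, §10.1] [cite: HusemollerFibreBundles1994, Ch. 17 §3 (C₁) and Prop. 4.1] -/
theorem chernPowerSum_restrictToOpen_eq_zero_of_comparison (hX : IsSmoothProjective n X)
    (E : ComplexVectorBundle.{0, 0} (ComplexPoints X))
    (α : ∀ U : X.left.Opens, Γ(F, U) → ∀ P : ComplexPoints X, E.E P)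
    (hcont : ∀ (U : X.left.Opens) (σ : Γ(F, U)),
      ContinuousOn (fun P ↦ (⟨P, α U σ P⟩ : TotalSpace E.F E.E)) {P | P.pt ∈ U})
    (hframe : ∀ (U : X.left.Opens) (t : Fin r → Γ(F, U)), IsSectionFrame F U t →
      ∀ P : ComplexPoints X, P.pt ∈ U → LinearIndependent ℂ (fun j ↦ α U (t j) P) ∧
        ⊤ ≤ Submodule.span ℂ (Set.range fun j ↦ α U (t j) P))
    {U : X.left.Opens} {t : Fin r → Γ(F, U)} (ht : IsSectionFrame F U t) {k : ℕ} (hk : 0 < k) :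
    restrictToCompl ℤ X (2 * k) ((U : Set X.left)ᶜ) (theChernClassTheory.chernPowerSum E k) = 0 := by
  obtain ⟨k, rfl⟩ := Nat.exists_eq_add_of_le' hk
  let f : C(complexPointsCompl X ((U : Set X.left)ᶜ), ComplexPoints X) := ⟨Subtype.val, continuous_subtype_val⟩
  change singularCohomology.map ℤ ℤ f (2 * (k + 1))
    (newtonPowerSum (ComplexPoints X) (theChernClassTheory.chernClass E) E.rank (k + 1)) = 0
  rw [← newtonPowerSum_map f (theChernClassTheory.chernClass E)
    (fun i ↦ singularCohomology.map ℤ ℤ f (2 * i) (theChernClassTheory.chernClass E i)) (fun i ↦ rfl) E.rank (k + 1)]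
  exact newtonPowerSum_succ_eq_zero _ _
    (fun i hi ↦ chernClassZ_restrictToOpen_eq_zero_of_comparison hX E α hcont hframe ht hi) k

/-- **`ch_k(E)|_{U(ℂ)} = 0`** (`k ≥ 1`) for every Zariski open `U` carrying an algebraic frame.
[cite: Hirzebruch1966, §10.1] [cite: HusemollerFibreBundles1994, Ch. 17 §3 (C₁) and Prop. 4.1] -/
theorem topologicalChernCharacter_restrictToOpen_eq_zero_of_comparison (hX : IsSmoothProjective n X)
    (E : ComplexVectorBundle.{0, 0} (ComplexPoints X))
    (α : ∀ U : X.left.Opens, Γ(F, U) → ∀ P : ComplexPoints X, E.E P)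
    (hcont : ∀ (U : X.left.Opens) (σ : Γ(F, U)),
      ContinuousOn (fun P ↦ (⟨P, α U σ P⟩ : TotalSpace E.F E.E)) {P | P.pt ∈ U})
    (hframe : ∀ (U : X.left.Opens) (t : Fin r → Γ(F, U)), IsSectionFrame F U t →
      ∀ P : ComplexPoints X, P.pt ∈ U → LinearIndependent ℂ (fun j ↦ α U (t j) P) ∧
        ⊤ ≤ Submodule.span ℂ (Set.range fun j ↦ α U (t j) P))
    {U : X.left.Opens} {t : Fin r → Γ(F, U)} (ht : IsSectionFrame F U t) {k : ℕ} (hk : 0 < k) :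
    restrictToCompl ℂ X (2 * k) ((U : Set X.left)ᶜ) (theChernClassTheory.topologicalChernCharacter ℂ E k) = 0 := by
  have h := chernPowerSum_restrictToOpen_eq_zero_of_comparison hX E α hcont hframe ht hk
  change singularCohomology.map ℂ ℂ _ (2 * k) ((((Nat.factorial k : ℕ) : ℂ))⁻¹ •
    singularCohomology.ringChange (Int.castRingHom ℂ) (ComplexPoints X) (2 * k) (theChernClassTheory.chernPowerSum E k)) = 0
  rw [map_smul, ← ringChange_map]
  change _ • singularCohomology.ringChange (Int.castRingHom ℂ) _ (2 * k)
    (restrictToCompl ℤ X (2 * k) ((U : Set X.left)ᶜ) (theChernClassTheory.chernPowerSum E k)) = 0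
  rw [h, map_zero, smul_zero]

/-- **`ch_k(E) ∈ N¹ H²ᵏ(X(ℂ); ℂ)`** (`k ≥ 1`) as soon as `F` has an algebraic frame over a non-empty
Zariski open. [cite: BlochOgus1974ENS, (3.8)] [cite: Hirzebruch1966, §10.1] -/
theorem topologicalChernCharacter_mem_coniveauFiltration_one_of_comparison (hX : IsSmoothProjective n X)
    (E : ComplexVectorBundle.{0, 0} (ComplexPoints X))
    (α : ∀ U : X.left.Opens, Γ(F, U) → ∀ P : ComplexPoints X, E.E P)
    (hcont : ∀ (U : X.left.Opens) (σ : Γ(F, U)),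
      ContinuousOn (fun P ↦ (⟨P, α U σ P⟩ : TotalSpace E.F E.E)) {P | P.pt ∈ U})
    (hframe : ∀ (U : X.left.Opens) (t : Fin r → Γ(F, U)), IsSectionFrame F U t →
      ∀ P : ComplexPoints X, P.pt ∈ U → LinearIndependent ℂ (fun j ↦ α U (t j) P) ∧
        ⊤ ≤ Submodule.span ℂ (Set.range fun j ↦ α U (t j) P))
    {U : X.left.Opens} (hU : (U : Set X.left).Nonempty) {t : Fin r → Γ(F, U)}
    (ht : IsSectionFrame F U t) {k : ℕ} (hk : 0 < k) :
    theChernClassTheory.topologicalChernCharacter ℂ E k ∈ coniveauFiltration ℂ X (2 * k) 1 := by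
  haveI := IsSmoothProjective.isIntegral_holds hX
  obtain ⟨x, hx⟩ := hU
  have hne : ((U : Set X.left)ᶜ) ≠ Set.univ := fun h ↦ (h ▸ Set.mem_univ x : x ∈ (U : Set X.left)ᶜ) hx
  exact (exists_ne_univ_restrictToCompl_eq_zero_iff_mem_coniveauFiltration_one ℂ _).1
    ⟨(U : Set X.left)ᶜ, U.2.isClosed_compl, hne,
      topologicalChernCharacter_restrictToOpen_eq_zero_of_comparison hX E α hcont hframe ht hk⟩

/-- **`ch₁(E) ∈ algebraicClasses X 1`** (`ch₁ = c₁`, and `c₁(E)_ℂ` is algebraic, K1c).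
[cite: Fulton1998, Prop. 19.1.2] [cite: Hirzebruch1966, §10.1] -/
theorem topologicalChernCharacter_one_mem_algebraicClasses_of_comparison (hX : IsSmoothProjective n X)
    (E : ComplexVectorBundle.{0, 0} (ComplexPoints X))
    (α : ∀ U : X.left.Opens, Γ(F, U) → ∀ P : ComplexPoints X, E.E P)
    (hcont : ∀ (U : X.left.Opens) (σ : Γ(F, U)),
      ContinuousOn (fun P ↦ (⟨P, α U σ P⟩ : TotalSpace E.F E.E)) {P | P.pt ∈ U})
    (hframe : ∀ (U : X.left.Opens) (t : Fin r → Γ(F, U)), IsSectionFrame F U t →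
      ∀ P : ComplexPoints X, P.pt ∈ U → LinearIndependent ℂ (fun j ↦ α U (t j) P) ∧
        ⊤ ≤ Submodule.span ℂ (Set.range fun j ↦ α U (t j) P))
    {U : X.left.Opens} (hU : (U : Set X.left).Nonempty) {t : Fin r → Γ(F, U)}
    (ht : IsSectionFrame F U t) :
    theChernClassTheory.topologicalChernCharacter ℂ E 1 ∈ algebraicClasses X 1 := by
  rw [theChernClassTheory.topologicalChernCharacter_one]
  exact chernClassIn_complex_one_mem_algebraicClasses_of_comparison hX E α hcont hframe hU ht

end Summit.HodgeConjecture.HodgeConjecture.Theorems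

end
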